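import Summits.ABC.StewartYu.PadicW80ParLE
import HarnessLib

/-!
# The `(log p)`-normalised parameter record `PadicW80ParL` — part F: the Siegel count and the rooms

Support file (theorems only; no named facts), cell `abc-stewartyu` (p1, stub S5 of memo-03 §4): twin of
`PadicW80ParF.lean` on the `ℓ`-normalised record. **`padic_siegel_count_real`**: `2·Mcl·S₀·#tauSet d T ≤ h L_b ∏(Lallᵢ+1)`
— the class price `Mcl` enters the count once (Yu 1990 (2.32): unknowns counted in ONE class) and the powers of `ℓ`
cancel exactly (`S₀^{m+1}` carries `ℓ^{−(m+1)}`, `U` carries `G ∏Vall /ℓ^{m+1}` through `nG (∏nV) nV_θ`);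
`padic_siegel_count` (the `Mcl ≥ 1` corollary in `ℕ`, the form `PadicCW77Siegel` consumes); `log p ≤ U` from
`log p ≤ ℓ`; `room_half`. Design note HOME/p1/S5-logp-ledger.md. [cite: Waldschmidt1980, Lemma 3.2 (p. 266)]
[cite: Yu1990, Lemma 2.1 and (2.32) (pp. 37, 40–43)]
-/

noncomputable section

open Finset Real
open Literature.NumberTheory.Transcendental Literature.NumberTheory.Transcendental.Waldschmidt1980

namespace Summit.ABC.StewartYu

open PadicW80Par (cTp cSp cLp cLp' Ap mRp)

namespace PadicW80ParL

open Literature.NumberTheory.Transcendental.CW77 Literature.NumberTheory.Transcendental.CW77.Setup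

/-- **The count of Lemma 3.2**: twice the number of equations `(s, τ)`, `s < S₀`, `|τ| < T`, is at
most the number of unknowns `#box₀ = h L_b ∏(Lallᵢ + 1)` — with the factorial of
`#tauSet ≤ (T+d)^{d+1}/(d+1)!` against the `m^{2m+1}/m!` of `U`.
[cite: Waldschmidt1980, Lemma 3.2 and (3.6) (pp. 264–267)] -/
theorem padic_siegel_count_real (S : CW77.Setup) (P : PadicW80ParL S.d) :
    2 * P.Mcl * ((P.S₀ℓ : ℝ) * ((tauSet S.d P.Tℓ).card : ℝ)) ≤ P.hparℓ * P.Lbℓ * ∏ i, ((P.Lallℓ i : ℝ) + 1) := by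
  -- notation and basic facts
  have hMcl := P.hMcl; have hℓ := P.ℓ_pos
  have hm0 := mR_pos P; have hm2 := two_le_mR P
  have hW := P.one_le_Wstar; have hG := P.G_pos; have hU := P.U_pos; have h𝔘 := P.𝔘_pos
  have hS := P.S₀_pos; have hT := P.T_pos
  have em : ((S.d + 1 : ℕ) : ℝ) = mRp S.d := by unfold mRp; push_cast; ring
  -- (1) the count of `τ`
  have h1 : ((tauSet S.d P.Tℓ).card : ℝ) ≤ (2 * (P.Tℓ : ℝ)) ^ (S.d + 1) / (S.d + 1).factorial := by
    have h := Waldschmidt1980.card_tauSet_le_pow_div_factorial S.d P.Tℓ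
    have hTd : (P.Tℓ : ℝ) + S.d ≤ 2 * P.Tℓ := by
      -- `d ≤ T` from `T ≥ 2^{11} m² nVθ Lθ ≥ 2^{11} m²`
      have h2 := P.T_ge_Lθ
      have hL : (1 : ℝ) ≤ P.Lθℓ := by exact_mod_cast P.one_le_Lθ
      have hV := P.one_le_nVθ
      have hd : (S.d : ℝ) ≤ mRp S.d := by unfold mRp; linarith
      have : (S.d : ℝ) ≤ 2 ^ 11 * mRp S.d ^ 2 * P.nVθ * P.Lθℓ := by
        have h3 : mRp S.d ≤ 2 ^ 11 * mRp S.d ^ 2 * P.nVθ * P.Lθℓ := by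
          calc mRp S.d = 1 * (mRp S.d * 1) * 1 * 1 := by ring
            _ ≤ 2 ^ 11 * (mRp S.d * mRp S.d) * P.nVθ * P.Lθℓ := by gcongr <;> linarith
            _ = 2 ^ 11 * mRp S.d ^ 2 * P.nVθ * P.Lθℓ := by ring
        linarith
      linarith
    calc ((tauSet S.d P.Tℓ).card : ℝ) ≤ ((P.Tℓ : ℝ) + S.d) ^ (S.d + 1) / (S.d + 1).factorial := h
      _ ≤ (2 * (P.Tℓ : ℝ)) ^ (S.d + 1) / (S.d + 1).factorial := by gcongr
  -- (2) `T ≤ 𝔘/(c_T W⋆)`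
  have h2 : (P.Tℓ : ℝ) ≤ P.𝔘ℓ / (cTp * P.Wstarℓ) := by
    have := P.T_le
    rw [P.U_eq] at this
    have e : 2 ^ (S.d + 1) * P.𝔘ℓ / (cTp * 2 ^ (S.d + 1) * P.Wstarℓ) = P.𝔘ℓ / (cTp * P.Wstarℓ) := by
      unfold cTp; field_simp
    rw [← e]; exact this
  -- (3) the lower bounds for the unknowns
  have h3 : P.𝔘ℓ / (cLp * P.Gℓ) ≤ (P.hparℓ : ℝ) * P.Lbℓ := by
    have hh := P.hpar_pos
    have hLb : P.Uℓ / (cLp * 2 ^ (S.d + 1) * P.Gℓ * P.hparℓ) ≤ (P.Lbℓ : ℝ) := by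
      unfold PadicW80ParL.Lbℓ; push_cast; exact (Nat.lt_floor_add_one _).le
    have e : P.Uℓ / (cLp * 2 ^ (S.d + 1) * P.Gℓ * P.hparℓ) = P.𝔘ℓ / (cLp * P.Gℓ) / P.hparℓ := by
      rw [P.U_eq]; unfold cLp; field_simp
    rw [e, div_le_iff₀ hh] at hLb
    linarith
  have h4 : ∀ i, P.Uℓ / (cLp' * mRp S.d * 2 ^ (S.d + 2) * P.S₀ℓ * P.Vallℓ i) ≤ (P.Lallℓ i : ℝ) + 1 := by
    intro i
    refine Fin.lastCases ?_ (fun j => ?_) i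
    · rw [P.Lall_last, P.Vall_last]; unfold PadicW80ParL.Lθℓ; exact (Nat.lt_floor_add_one _).le
    · rw [P.Lall_castSucc, P.Vall_castSucc]; unfold PadicW80ParL.Lℓ; exact (Nat.lt_floor_add_one _).le
  set D : ℝ := cLp' * mRp S.d * 2 ^ (S.d + 2) * P.S₀ℓ with hD
  have hD0 : 0 < D := by rw [hD]; unfold cLp'; positivity
  have h5 : P.Uℓ ^ (S.d + 1) / (D ^ (S.d + 1) * ∏ i, P.Vallℓ i) ≤ ∏ i, ((P.Lallℓ i : ℝ) + 1) := by
    have e : P.Uℓ ^ (S.d + 1) / (D ^ (S.d + 1) * ∏ i, P.Vallℓ i) = ∏ i, (P.Uℓ / (D * P.Vallℓ i)) := by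
      rw [prod_div_distrib, prod_const, card_univ, Fintype.card_fin, prod_mul_distrib, prod_const, card_univ,
        Fintype.card_fin]
    rw [e]
    refine prod_le_prod (fun i _ => by have := P.Vall_pos i; positivity) fun i _ => ?_
    have := h4 i
    rwa [show cLp' * mRp S.d * 2 ^ (S.d + 2) * (P.S₀ℓ : ℝ) * P.Vallℓ i = D * P.Vallℓ i by rw [hD]] at this
  -- (4) the numerical heart: `2 S₀ (2𝔘/(c_T W⋆))^m/m! ≤ (𝔘/(c_L G)) · U^m/(D^m ∏Vall)`
  have hVall : 0 < ∏ i, P.Vallℓ i := prod_pos fun i _ => P.Vall_pos i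
  have hfac : (0 : ℝ) < (S.d + 1).factorial := by exact_mod_cast Nat.factorial_pos _
  set A₁ : ℝ := 2 * P.Mcl * P.S₀ℓ * (2 * P.𝔘ℓ) ^ (S.d + 1) with hA₁
  set B₁ : ℝ := (cTp * P.Wstarℓ) ^ (S.d + 1) * (S.d + 1).factorial with hB₁
  set A₂ : ℝ := P.𝔘ℓ * P.Uℓ ^ (S.d + 1) with hA₂
  set B₂ : ℝ := cLp * P.Gℓ * (D ^ (S.d + 1) * ∏ i, P.Vallℓ i) with hB₂
  have hB₁0 : 0 < B₁ := by rw [hB₁]; unfold cTp; positivity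
  have hB₂0 : 0 < B₂ := by rw [hB₂]; unfold cLp; positivity
  have eL : 2 * P.Mcl * ((P.S₀ℓ : ℝ) * ((2 * (P.𝔘ℓ / (cTp * P.Wstarℓ))) ^ (S.d + 1) / (S.d + 1).factorial)) = A₁ / B₁ := by
    rw [hA₁, hB₁, show (2 : ℝ) * (P.𝔘ℓ / (cTp * P.Wstarℓ)) = (2 * P.𝔘ℓ) / (cTp * P.Wstarℓ) by ring, div_pow]
    field_simp
  have eR : (P.𝔘ℓ / (cLp * P.Gℓ)) * (P.Uℓ ^ (S.d + 1) / (D ^ (S.d + 1) * ∏ i, P.Vallℓ i)) = A₂ / B₂ := by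
    rw [hA₂, hB₂, div_mul_div_comm]
  have heart : A₁ / B₁ ≤ A₂ / B₂ := by
    rw [div_le_div_iff₀ hB₁0 hB₂0, hA₁, hB₁, hA₂, hB₂]
    -- `2 S₀ (2𝔘)^m · c_L G D^m ∏Vall ≤ 𝔘 U^m · (c_T W⋆)^m m!`
    rw [P.U_eq]
    have hprodV : (∏ i, P.Vallℓ i) = (∏ j, P.V j) * P.Vθ := by rw [Fin.prod_univ_castSucc]; simp
    have hprodn : (∏ j, P.V j) * P.Vθ = P.ℓ ^ (S.d + 1) * ((∏ j, P.nV j) * P.nVθ) := by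
      rw [prod_congr rfl fun j _ => P.V_eq j, prod_mul_distrib, prod_const, card_univ, Fintype.card_fin, P.Vθ_eq]
      ring
    have h𝔘eq : P.𝔘ℓ * ((S.d + 1).factorial : ℝ) * 2 ^ (S.d + 1) =
        P.Mcl * PadicW80Par.Ap ^ (S.d + 1) * mRp S.d ^ (2 * S.d + 3) * ((∏ j, P.nV j) * P.nVθ) * P.Wstarℓ * P.nGℓ := by
      unfold PadicW80ParL.𝔘ℓ PadicW80ParL.Uℓ; field_simp
    have hS₀ := P.S₀_le
    have hS0' : (0 : ℝ) ≤ P.S₀ℓ := hS.le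
    have hnW := P.one_le_nWstar
    have LHS_le : 2 * P.Mcl * (P.S₀ℓ : ℝ) * (2 * P.𝔘ℓ) ^ (S.d + 1) * (cLp * P.Gℓ * (D ^ (S.d + 1) * ∏ i, P.Vallℓ i)) ≤
        2 * P.Mcl * (2 * (cSp * mRp S.d * P.nWstarℓ)) * (2 * P.𝔘ℓ) ^ (S.d + 1) *
          (cLp * P.Gℓ * ((cLp' * mRp S.d * 2 ^ (S.d + 2) * (2 * (cSp * mRp S.d * P.nWstarℓ))) ^ (S.d + 1) * ∏ i, P.Vallℓ i)) := by
      have hDle : D ≤ cLp' * mRp S.d * 2 ^ (S.d + 2) * (2 * (cSp * mRp S.d * P.nWstarℓ)) := by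
        rw [hD]; unfold cLp'; gcongr
      have hcS : (0 : ℝ) < cSp := by unfold cSp; norm_num
      have hcL : (0 : ℝ) < cLp := by unfold cLp; norm_num
      have h0 : (0 : ℝ) ≤ 2 * P.Mcl * (2 * (cSp * mRp S.d * P.nWstarℓ)) * (2 * P.𝔘ℓ) ^ (S.d + 1) := by positivity
      gcongr
    refine LHS_le.trans ?_
    have e3 : ((2 : ℝ) ^ (S.d + 1)) ^ (S.d + 1) = (2 ^ (S.d + 1)) ^ S.d * 2 ^ (S.d + 1) := pow_succ _ _
    have eRR : P.𝔘ℓ * (2 ^ (S.d + 1) * P.𝔘ℓ) ^ (S.d + 1) * ((cTp * P.Wstarℓ) ^ (S.d + 1) * (S.d + 1).factorial) =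
        (P.𝔘ℓ * ((S.d + 1).factorial : ℝ) * 2 ^ (S.d + 1)) * (2 ^ (S.d + 1)) ^ S.d * P.𝔘ℓ ^ (S.d + 1) * cTp ^ (S.d + 1) *
          P.Wstarℓ ^ (S.d + 1) := by
      rw [mul_pow, mul_pow, e3]; ring
    rw [eRR, h𝔘eq, hprodV, hprodn, P.Wstar_eq, P.G_eq]
    unfold cSp cLp cLp' cTp
    -- both sides are a constant times `M`
    set M : ℝ := P.Mcl * mRp S.d ^ (2 * S.d + 3) * ((∏ j, P.nV j) * P.nVθ) * P.nGℓ * P.𝔘ℓ ^ (S.d + 1) *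
      P.nWstarℓ ^ (S.d + 2) * P.ℓ ^ (S.d + 2) with hM
    have key : (2 : ℝ) * P.Mcl * (2 * (2 ^ 15 * mRp S.d * P.nWstarℓ)) * (2 * P.𝔘ℓ) ^ (S.d + 1) *
        (2 ^ 14 * (P.ℓ * P.nGℓ) * ((2 ^ 12 * mRp S.d * 2 ^ (S.d + 2) * (2 * (2 ^ 15 * mRp S.d * P.nWstarℓ))) ^ (S.d + 1) *
          (P.ℓ ^ (S.d + 1) * ((∏ j, P.nV j) * P.nVθ))))
        = ((2 : ℝ) ^ 1 * 2 ^ 1 * 2 ^ 15 * 2 ^ 14 * 2 ^ (S.d + 1) * (2 ^ 12 * 2 ^ (S.d + 2) * 2 ^ 1 * 2 ^ 15) ^ (S.d + 1)) * M := by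
      rw [hM]
      have e1 : mRp S.d ^ (2 * S.d + 3) = mRp S.d * (mRp S.d * mRp S.d) ^ (S.d + 1) := by ring
      have e2 : P.nWstarℓ ^ (S.d + 2) = P.nWstarℓ * P.nWstarℓ ^ (S.d + 1) := by ring
      have e4 : P.ℓ ^ (S.d + 2) = P.ℓ * P.ℓ ^ (S.d + 1) := by ring
      rw [e1, e2, e4]; ring
    rw [key]
    have key2 : P.Mcl * PadicW80Par.Ap ^ (S.d + 1) * mRp S.d ^ (2 * S.d + 3) * ((∏ j, P.nV j) * P.nVθ) *
        (P.ℓ * P.nWstarℓ) * P.nGℓ * (2 ^ (S.d + 1)) ^ S.d * P.𝔘ℓ ^ (S.d + 1) * (2 ^ 14) ^ (S.d + 1) *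
        (P.ℓ * P.nWstarℓ) ^ (S.d + 1)
        = (PadicW80Par.Ap ^ (S.d + 1) * ((2 : ℝ) ^ (S.d + 1)) ^ S.d * (2 ^ 14) ^ (S.d + 1)) * M := by
      rw [hM]
      have e2 : P.nWstarℓ ^ (S.d + 2) = P.nWstarℓ * P.nWstarℓ ^ (S.d + 1) := by ring
      have e4 : P.ℓ ^ (S.d + 2) = P.ℓ * P.ℓ ^ (S.d + 1) := by ring
      rw [e2, e4, mul_pow]; ring
    rw [key2]
    have hnV0 : 0 ≤ (∏ j, P.nV j) * P.nVθ := le_trans zero_le_one P.one_le_prodnVVθ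
    have hM0 : 0 ≤ M := by rw [hM]; have := P.nG_pos; positivity
    refine mul_le_mul_of_nonneg_right ?_ hM0
    -- constants: `2^{30+d} · 2^{(28+d)(d+1)} ≤ 2^{50(d+1)} · 2^{(d+1)d} · 2^{14(d+1)}`
    rw [show PadicW80Par.Ap = (2 : ℝ) ^ 50 from rfl]
    have hexp : 1 + 1 + 15 + 14 + (S.d + 1) + (12 + (S.d + 2) + 1 + 15) * (S.d + 1) ≤
        50 * (S.d + 1) + (S.d + 1) * S.d + 14 * (S.d + 1) := by
      have e : (12 + (S.d + 2) + 1 + 15) * (S.d + 1) = 30 * (S.d + 1) + (S.d + 1) * S.d := by ring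
      rw [e]
      generalize (S.d + 1) * S.d = q
      omega
    calc (2 : ℝ) ^ 1 * 2 ^ 1 * 2 ^ 15 * 2 ^ 14 * 2 ^ (S.d + 1) * (2 ^ 12 * 2 ^ (S.d + 2) * 2 ^ 1 * 2 ^ 15) ^ (S.d + 1)
        = 2 ^ (1 + 1 + 15 + 14 + (S.d + 1) + (12 + (S.d + 2) + 1 + 15) * (S.d + 1)) := by
          simp only [← pow_mul, ← pow_add]
      _ ≤ 2 ^ (50 * (S.d + 1) + (S.d + 1) * S.d + 14 * (S.d + 1)) := pow_le_pow_right₀ (by norm_num) hexp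
      _ = (2 ^ 50) ^ (S.d + 1) * (2 ^ (S.d + 1)) ^ S.d * (2 ^ 14) ^ (S.d + 1) := by
          simp only [← pow_mul, ← pow_add]
  -- (5) combine
  calc (2 : ℝ) * P.Mcl * (P.S₀ℓ * ((tauSet S.d P.Tℓ).card : ℝ))
      ≤ 2 * P.Mcl * (P.S₀ℓ * ((2 * (P.Tℓ : ℝ)) ^ (S.d + 1) / (S.d + 1).factorial)) := by gcongr
    _ ≤ 2 * P.Mcl * (P.S₀ℓ * ((2 * (P.𝔘ℓ / (cTp * P.Wstarℓ))) ^ (S.d + 1) / (S.d + 1).factorial)) := by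
        gcongr
    _ = A₁ / B₁ := eL
    _ ≤ A₂ / B₂ := heart
    _ = (P.𝔘ℓ / (cLp * P.Gℓ)) * (P.Uℓ ^ (S.d + 1) / (D ^ (S.d + 1) * ∏ i, P.Vallℓ i)) := eR.symm
    _ ≤ (P.hparℓ * P.Lbℓ) * ∏ i, ((P.Lallℓ i : ℝ) + 1) := by
        refine mul_le_mul h3 h5 (by positivity) (by positivity)
    _ = P.hparℓ * P.Lbℓ * ∏ i, ((P.Lallℓ i : ℝ) + 1) := by ring

/-- **The count of Lemma 3.2** (the `Mcl ≥ 1` corollary in `ℕ`): twice the number of equations `(s, τ)`,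
`s < S₀`, `|τ| < T`, is at most the number of unknowns `#box₀ = h L_b ∏(Lallᵢ + 1)`.
[cite: Waldschmidt1980, Lemma 3.2 and (3.6) (pp. 264–267)] -/
theorem padic_siegel_count (S : CW77.Setup) (P : PadicW80ParL S.d) :
    2 * ((range P.S₀ℓ) ×ˢ tauSet S.d P.Tℓ).card ≤ (S.box (h := P.hparℓ) (Lb := P.Lbℓ) P.Lℓ P.Lθℓ 0).card := by
  rw [S.card_box, card_product, card_range]
  simp only [pow_zero, Nat.div_one]
  have hprodL : (∏ j, (P.Lℓ j + 1)) * (P.Lθℓ + 1) = ∏ i, (P.Lallℓ i + 1) := by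
    rw [Fin.prod_univ_castSucc]; simp
  rw [hprodL]
  have key := padic_siegel_count_real S P
  have hM := P.hMcl
  have h0 : (0 : ℝ) ≤ (P.S₀ℓ : ℝ) * ((tauSet S.d P.Tℓ).card : ℝ) := by positivity
  have key' : (2 : ℝ) * (P.S₀ℓ * ((tauSet S.d P.Tℓ).card : ℝ)) ≤ P.hparℓ * P.Lbℓ * ∏ i, ((P.Lallℓ i : ℝ) + 1) := by
    calc (2 : ℝ) * (P.S₀ℓ * ((tauSet S.d P.Tℓ).card : ℝ)) = 2 * 1 * (P.S₀ℓ * ((tauSet S.d P.Tℓ).card : ℝ)) := by ring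
      _ ≤ 2 * P.Mcl * (P.S₀ℓ * ((tauSet S.d P.Tℓ).card : ℝ)) := by gcongr
      _ ≤ _ := key
  exact_mod_cast key'

variable {d : ℕ} (P : PadicW80ParL d)

/-! ### Two small inputs of the parameter pack: `log p ≤ U` and the rooms -/

/-- `ℓ ≤ W⋆ ≤ U`. [folklore] -/
theorem ℓ_le_U : P.ℓ ≤ P.Uℓ := by
  have h := P.U_div_ge'
  have hW := P.one_le_Wstar; have hU := P.U_pos; have hℓW := P.ℓ_le_Wstar
  have h2 : (1 : ℝ) ≤ 2 ^ (49 * (d + 1)) := one_le_pow₀ (by norm_num)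
  have h2d : (1 : ℝ) ≤ 2 ^ (d + 1) := one_le_pow₀ (by norm_num)
  rw [le_div_iff₀ (by positivity)] at h
  have h3 : P.Wstarℓ ≤ 2 ^ (49 * (d + 1)) * (2 ^ (d + 1) * P.Wstarℓ) := by
    calc P.Wstarℓ = 1 * (1 * P.Wstarℓ) := by ring
      _ ≤ 2 ^ (49 * (d + 1)) * (2 ^ (d + 1) * P.Wstarℓ) := by gcongr
  linarith

/-- `log p ≤ U` from `log p ≤ ℓ` (the instantiation `ℓ = log p`). [cite: Waldschmidt1980, §3.2 (p. 264)] -/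
theorem log_p_le_U {p : ℕ} (hp : Real.log p ≤ P.ℓ) : Real.log p ≤ P.Uℓ := hp.trans P.ℓ_le_U

/-- Room for the inner chain AND the half step: `2(d+1)·t_J ≤ T/2^J` (`t_J = ⌊(T/2^J)/(2m)⌋`),
hence `(d+1)·t_J ≤ T/2^J` and `T/2^{J+1} + t_J ≤ T/2^J − d·t_J`… in the form p3's J3 uses:
`T/2^(J+1) + (d+1)·t_J ≤ T/2^J`. [cite: Waldschmidt1980, Lemma 3.6 (p. 272)] -/
theorem room_half (J : ℕ) : P.Tℓ / 2 ^ (J + 1) + (d + 1) * P.tJℓ J ≤ P.Tℓ / 2 ^ J := by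
  have h : 2 * ((d + 1) * P.tJℓ J) ≤ P.Tℓ / 2 ^ J := by
    have := P.tJ_mul_le J; rwa [mul_assoc] at this
  have h2 : P.Tℓ / 2 ^ (J + 1) = P.Tℓ / 2 ^ J / 2 := by
    rw [pow_succ, Nat.div_div_eq_div_mul]
  rw [h2]
  omega

end PadicW80ParL

end Summit.ABC.StewartYu

end
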